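import Summits.ResolutionOfSingularities.ResolutionOfSingularities.Theorems.EquisingularLiftEquisingularLiftNatHyperplaneLetter
import Summits.ResolutionOfSingularities.ResolutionOfSingularities.Theorems.EquisingularLiftEquisingularLiftNatSaturatedLift
import HarnessLib

/-!
# [OURS · L1 W4.5(b) · EL♮(3) · door ν4, brick N-0 (JINIT at `RD := RPlus`), piece (C-L)] THE HOST LETTER AS A `projIdealSheaf`:
# `ker (Proj g) = (ker g)~` for surjective graded `g`, and ★ `letter_clauses_projIdealSheaf` — the five `LetterDatum` clauses for `𝓛₀ = (![L̃])~`

res-L1-w45b-nose-w1 g4 (WIDTH seat D-0157 DOOR 1; N-0 owner).  DEF-FREE; no `sorry`; standard axioms.  `--supports stmt-ResolutionOfSingularities-20148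
--as helper`, counted 0.

WHY.  Level B of the N-0 conditional assembly (✓ `jinit_rPlus₀_of_noseDatum₂`) takes the host letter in the SAME currency as the nose model
(✓ `…NatEquinodalNoseModel`: `𝓦₀ = (![L̃, Ĝ])~ := projIdealSheaf ⟨span (range ![L̃, Ĝ]), _⟩`), namely `𝓛₀ := projIdealSheaf ⟨span (range ![L̃]), _⟩`, so
that `𝓛₀ ≤ 𝓦₀` is monotonicity (✓ `NoseModel.letter_le_nose`).  res-type-027's ✓ `LinearLetter.exists_hyperplane_model` proves the five `LetterDatum`
clauses for the model `ker (Proj f_O)` of its kill substitution `f_O` (`ker f_O = (L̃)`).  THIS FILE identifies the two: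
* `ker_projMap_eq_projIdealSheaf` — for a SURJECTIVE graded `g` out of `R[x₀..xₙ]` with `ker g = I`: `(Proj.map g).ker = projIdealSheaf I` (both have
  sections `I_{(x_i)}` over every chart `D₊(x_i)`: Literature ✓ `ker_projMap_ideal_basicOpen` / ✓ `projIdealSheaf_ideal_basicOpen`; `ext_of_iSup_eq_top`);
* ★ `letter_clauses_projIdealSheaf` — ✓ `exists_hyperplane_model`'s hypotheses VERBATIM ⊢ the five clauses (reduced trace `𝓘⟨closure V₊(ℓ)⟩`,
  principal stalks, `V(𝓛₀)` regular, off the generic point of `range (ι ≫ Proj φ)`, `O`-flat) for `𝓛₀ = (![Σ C (c i) X i])~`.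
EL♮(3) is NOT proved; resolution of singularities in positive characteristic is NOT proved.
-/

set_option linter.dupNamespace false -- mandated namespace `Summit.<Summit>.<Problem>` of this single-conjunct summit
set_option linter.overlappingInstances false -- signatures carry `[IsDomain O] [IsDiscreteValuationRing O]`

noncomputable section

open CategoryTheory AlgebraicGeometry TopologicalSpace
open MvPolynomial HomogeneousLocalization
open Literature.AlgebraicGeometry.Resolution Literature.RingTheory.GradedAlgebra
open AlgebraicGeometry.Scheme.IdealSheafData

namespace Summit.ResolutionOfSingularities.ResolutionOfSingularities.Cruxes.EquisingularLiftNat.Sections.Equinodal.LetterModel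

/-! ## §1 `ker (Proj g) = (ker g)~` for surjective graded `g` out of a polynomial ring -/

/-- **`(Proj.map g).ker = projIdealSheaf I`** for a SURJECTIVE graded homomorphism `g : R[x₀..xₙ] → B` with `ker g = I`: over every chart `D₊(x_i)` both
ideal sheaves have sections `I_{(x_i)}`. [cite: Hartshorne1977, II Prop. 5.9 and Ex. 3.12 (a)] -/
theorem ker_projMap_eq_projIdealSheaf (R : Type) [CommRing R] (n : ℕ) {B τ : Type} [CommRing B] [SetLike τ B] [AddSubgroupClass τ B]
    {ℬ : ℕ → τ} [GradedRing ℬ] :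
    letI := MvPolynomial.gradedAlgebra (σ := Fin (n + 1)) (R := R)
    ∀ (g : homogeneousSubmodule (Fin (n + 1)) R →+*ᵍ ℬ)
      (hg : HomogeneousIdeal.irrelevant ℬ ≤ (HomogeneousIdeal.irrelevant (homogeneousSubmodule (Fin (n + 1)) R)).map g)
      (_hsurj : Function.Surjective g) (I : HomogeneousIdeal (homogeneousSubmodule (Fin (n + 1)) R)) (_hI : RingHom.ker g = I.toIdeal),
      (Proj.map g hg).ker = projIdealSheaf (homogeneousSubmodule (Fin (n + 1)) R) I := by
  letI := MvPolynomial.gradedAlgebra (σ := Fin (n + 1)) (R := R)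
  intro g hg hsurj I hI
  refine Scheme.IdealSheafData.ext_of_iSup_eq_top
    (fun i : Fin (n + 1) => (⟨Proj.basicOpen (homogeneousSubmodule (Fin (n + 1)) R) (X i),
      Proj.isAffineOpen_basicOpen (homogeneousSubmodule (Fin (n + 1)) R) (X i) (CILift.X_mem_one' i) one_pos⟩ :
        (Proj (homogeneousSubmodule (Fin (n + 1)) R)).affineOpens)) (SatLift.iSup_chart_eq_top R n) fun i => ?_
  rw [ker_projMap_ideal_basicOpen g hg hsurj one_pos (CILift.X_mem_one' i), hI,
    projIdealSheaf_ideal_basicOpen _ I one_pos (CILift.X_mem_one' i)]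

/-- `span (range ![a]) = span {a}`. [folklore] -/
theorem span_range_single {A : Type*} [CommRing A] (a : A) : Ideal.span (Set.range ![a]) = Ideal.span {a} := by
  rw [Matrix.range_cons, Matrix.range_empty, Set.union_empty]

/-! ## §2 The five letter clauses for `𝓛₀ = (![L̃])~` -/

section Letter

variable {O k : Type} [CommRing O] [IsDomain O] [IsDiscreteValuationRing O] [Field k] (π : O →+* k)
  (hπ : Function.Surjective π) {r : ℕ}

include hπ in
/-- ★ **THE HOST LETTER `(![L̃])~` HAS THE FIVE `LetterDatum` CLAUSES AT THE INITIAL STAGE.**  Inputs = res-type-027's ✓ `LinearLetter.exists_hyperplane_model`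
VERBATIM (`c : Fin (r+2) → O` with `c a · w = 1`, `ℓ = π (Σ C (c i) X i)`, `H ⊄ V₊(ℓ)`); output = its five clauses for the `projIdealSheaf` form
`𝓛₀ := projIdealSheaf ⟨span (range ![Σ C (c i) X i]), _⟩` (same degrees dress `![1]` as ✓ NoseModel's `letter_le_nose`): reduced trace
`𝓛₀ · 𝒪_{ℙ_k} = 𝓘⟨closure {y | ℓ ∈ 𝔭_y}⟩`, principal stalks, `V(𝓛₀)` regular, `𝟙 '' supp 𝓛₀` off the generic point of `range (ι ≫ Proj φ)`, `O`-flat.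
[OURS · brick N-0 core (C-L); counted 0] -/
theorem letter_clauses_projIdealSheaf :
    letI := MvPolynomial.gradedAlgebra (σ := Fin (r + 1 + 1)) (R := O)
    letI := MvPolynomial.gradedAlgebra (σ := Fin (r + 1 + 1)) (R := k)
    ∀ (φ : (homogeneousSubmodule (Fin (r + 1 + 1)) O) →+*ᵍ (homogeneousSubmodule (Fin (r + 1 + 1)) k))
      (_hφ : ∀ q, φ q = MvPolynomial.map π q)
      (hφ' : HomogeneousIdeal.irrelevant (homogeneousSubmodule (Fin (r + 1 + 1)) k) ≤
        (HomogeneousIdeal.irrelevant (homogeneousSubmodule (Fin (r + 1 + 1)) O)).map φ)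
      (c : Fin (r + 1 + 1) → O) (a : Fin (r + 1 + 1)) (w : O) (_hw : c a * w = 1)
      (ℓ : MvPolynomial (Fin (r + 1 + 1)) k) (_hℓ : MvPolynomial.map π (∑ i, C (c i) * X i) = ℓ)
      (H : Scheme.{0}) [IsIntegral H] (ι : H ⟶ Proj (homogeneousSubmodule (Fin (r + 1 + 1)) k)) [IsClosedImmersion ι]
      (_hH : ¬ Set.range ι ⊆ {y | ℓ ∈ y.asHomogeneousIdeal})
      (hL : ∀ l, (![∑ i, C (c i) * X i] : Fin 1 → MvPolynomial (Fin (r + 1 + 1)) O) l ∈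
        homogeneousSubmodule (Fin (r + 1 + 1)) O ((![1] : Fin 1 → ℕ) l)),
      (projIdealSheaf (homogeneousSubmodule (Fin (r + 1 + 1)) O)
          ⟨Ideal.span (Set.range ![∑ i, C (c i) * X i]), isHomogeneous_span_of_forall_mem _ _ _ hL⟩).comap (Proj.map φ hφ') =
          vanishingIdeal (⟨closure {y : Proj (homogeneousSubmodule (Fin (r + 1 + 1)) k) | ℓ ∈ y.asHomogeneousIdeal},
            isClosed_closure⟩ : Closeds (Proj (homogeneousSubmodule (Fin (r + 1 + 1)) k))) ∧
      (∀ z : Proj (homogeneousSubmodule (Fin (r + 1 + 1)) O),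
        (stalkIdeal (projIdealSheaf (homogeneousSubmodule (Fin (r + 1 + 1)) O)
          ⟨Ideal.span (Set.range ![∑ i, C (c i) * X i]), isHomogeneous_span_of_forall_mem _ _ _ hL⟩) z).IsPrincipal) ∧
      Scheme.IsRegular (projIdealSheaf (homogeneousSubmodule (Fin (r + 1 + 1)) O)
          ⟨Ideal.span (Set.range ![∑ i, C (c i) * X i]), isHomogeneous_span_of_forall_mem _ _ _ hL⟩).subscheme ∧
      (𝟙 (Proj (homogeneousSubmodule (Fin (r + 1 + 1)) O)) : _ ⟶ _) ''
          ((projIdealSheaf (homogeneousSubmodule (Fin (r + 1 + 1)) O)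
            ⟨Ideal.span (Set.range ![∑ i, C (c i) * X i]), isHomogeneous_span_of_forall_mem _ _ _ hL⟩).support :
              Set (Proj (homogeneousSubmodule (Fin (r + 1 + 1)) O))) ⊆
        {x | ¬ IsGenericPoint x (Set.range (ι ≫ Proj.map φ hφ'))} ∧
      Flat ((projIdealSheaf (homogeneousSubmodule (Fin (r + 1 + 1)) O)
          ⟨Ideal.span (Set.range ![∑ i, C (c i) * X i]), isHomogeneous_span_of_forall_mem _ _ _ hL⟩).subschemeι ≫ 𝟙 _ ≫
        (Proj.toSpecZero (homogeneousSubmodule (Fin (r + 1 + 1)) O) ≫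
          Spec.map (CommRingCat.ofHom (algebraMap O ((homogeneousSubmodule (Fin (r + 1 + 1)) O) 0))))) := by
  letI := MvPolynomial.gradedAlgebra (σ := Fin (r + 1 + 1)) (R := O)
  letI := MvPolynomial.gradedAlgebra (σ := Fin (r + 1 + 1)) (R := k)
  letI := MvPolynomial.gradedAlgebra (σ := Fin (r + 1)) (R := O)
  letI := MvPolynomial.gradedAlgebra (σ := Fin (r + 1)) (R := k)
  intro φ hφ hφ' c a w hw ℓ hℓ H _ ι _ hH hL
  obtain ⟨fO, hfO', hfOC, hfOe, hker, h1, h2, h3, h4, h5⟩ :=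
    LinearLetter.exists_hyperplane_model π hπ φ hφ hφ' c a w hw hℓ ι hH
  have hsurj : Function.Surjective fO := LinearLetter.subst_surjective (Fin.succAbove a) fO.toRingHom hfOC hfOe
  have hI : RingHom.ker fO = HomogeneousIdeal.toIdeal (⟨Ideal.span (Set.range ![∑ i, C (c i) * X i]), isHomogeneous_span_of_forall_mem _ _ _ hL⟩ :
      HomogeneousIdeal (homogeneousSubmodule (Fin (r + 1 + 1)) O)) := by
    rw [hker]
    exact (span_range_single _).symm
  have heq := ker_projMap_eq_projIdealSheaf O (r + 1) fO hfO' hsurj _ hI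
  rw [← heq]
  exact ⟨h1, h2, h3, h4, h5⟩

end Letter

end Summit.ResolutionOfSingularities.ResolutionOfSingularities.Cruxes.EquisingularLiftNat.Sections.Equinodal.LetterModel

end
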